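import Mathlib.Analysis.Complex.Exponential
import Mathlib.Analysis.SpecialFunctions.Exp
import Mathlib.Algebra.BigOperators.Field
import Mathlib.Algebra.Order.BigOperators.Group.Finset
import HarnessLib

/-!
# Chernoff bounds for adapted indicator sums, counting form

A finite, measure-free version of the Chernoff bound for sums of indicators that are NOT
independent but whose conditional probabilities given the past are controlled — the form in which
it is used for subword statistics of random reduced words (D. Calegari, A. Walker, *Random rigidity
in the free group*, Geom. Topol. 17 (2013), Lemma 2.5 and Prop. 2.3: "we can compare the number of
`σ`s among the `v_{j,i}` with a sum of independent Bernoulli variables, and estimate the deviation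
from the mean using the Chernoff bound"), and more generally for any finite uniform probability
space explored block by block.

Setting: a finite set `s` (uniform probability), events `X t` (`t = 0, 1, …`), and for each `t` a
*key* `key t : Ω → κ t` (the past at time `t`) such that the earlier events `X u`, `u < t`, are
determined by `key t`. If on every fibre of `key t` the event `X t` has relative frequency at most
`p` (resp. at least `q`), then the exponential moments of `S_T = ∑_{t<T} [X t]` factorise as for
independent Bernoulli variables:

* `∑_ω exp(λ S_T(ω)) ≤ (1 + p(e^λ − 1))^T · #s` for `λ ≥ 0` (`sum_exp_mul_sum_indicator_le_pow`),
  and the same with `q` for `λ ≤ 0`;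
* Markov then gives `#{S_T ≥ a} ≤ #s · exp(T p (e^λ − 1) − λ a)` and
  `#{S_T ≤ a} ≤ #s · exp(T q (e^{−λ} − 1) + λ a)` (`card_filter_sum_indicator_ge_le`,
  `card_filter_sum_indicator_le_le`);
* and the usual small-deviation forms `#{S_T ≥ (1+δ) T p} ≤ #s · exp(−δ² T p / 4)`,
  `#{S_T ≤ (1−δ) T q} ≤ #s · exp(−δ² T q / 4)` for `0 ≤ δ ≤ 2`
  (`card_filter_sum_indicator_ge_le_exp`, `card_filter_sum_indicator_le_le_exp`).

Everything is proved; constants are not optimised (`/4` instead of `/3`, `/2`).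

## References
* [CalegariWalker2013] D. Calegari, A. Walker, Geom. Topol. 17 (2013), §2.4 (Lemma 2.5).
* W. Hoeffding (1963); H. Chernoff (1952) — the classical independent case.
-/

noncomputable section

open Finset Real

namespace Literature.Probability.Moments

/-! ### One step: exponential moment of `g(key ω) + [X ω]` over the fibres of `key` -/

/-- **One-step factorisation.** If on every fibre `F_v = {ω ∈ s : key ω = v}` the sign condition
`(e^λ − 1) · (#(F_v ∩ X) − r · #F_v) ≤ 0` holds (i.e. the relative frequency of `X` on each fibre is
`≤ r` when `λ ≥ 0`, `≥ r` when `λ ≤ 0`), then for any `g` constant on fibres,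
`∑_ω exp(λ (g(key ω) + [X ω])) ≤ (1 + r(e^λ − 1)) ∑_ω exp(λ g(key ω))`. [folklore] -/
theorem sum_exp_mul_add_indicator_le {Ω κ : Type*} [DecidableEq κ] (s : Finset Ω)
    (key : Ω → κ) (g : κ → ℝ) (X : Ω → Prop) [DecidablePred X] (r l : ℝ)
    (h : ∀ v ∈ s.image key, (Real.exp l - 1) *
      ((((s.filter fun ω => key ω = v).filter X).card : ℝ) -
        r * ((s.filter fun ω => key ω = v).card : ℝ)) ≤ 0) :
    ∑ ω ∈ s, Real.exp (l * (g (key ω) + if X ω then 1 else 0)) ≤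
      (1 + r * (Real.exp l - 1)) * ∑ ω ∈ s, Real.exp (l * g (key ω)) := by
  have hmaps : ∀ ω ∈ s, key ω ∈ s.image key := fun ω hω => mem_image_of_mem key hω
  rw [← sum_fiberwise_of_maps_to hmaps, ← sum_fiberwise_of_maps_to hmaps
    (f := fun ω => Real.exp (l * g (key ω))), mul_sum]
  refine sum_le_sum fun v hv => ?_
  set F := s.filter fun ω => key ω = v with hF
  have e1 : ∑ ω ∈ F, Real.exp (l * (g (key ω) + if X ω then 1 else 0)) =
      Real.exp (l * g v) * ((F.card : ℝ) + (Real.exp l - 1) * ((F.filter X).card : ℝ)) := by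
    have hc : ∀ ω ∈ F, Real.exp (l * (g (key ω) + if X ω then 1 else 0)) =
        Real.exp (l * g v) * (if X ω then Real.exp l else 1) := by
      intro ω hω
      rw [(mem_filter.mp hω).2]
      split_ifs
      · rw [mul_add, mul_one, Real.exp_add]
      · rw [add_zero, mul_one]
    rw [sum_congr rfl hc, ← mul_sum, sum_ite, sum_const, sum_const, nsmul_eq_mul, nsmul_eq_mul,
      mul_one]
    congr 1
    have hsplit := card_filter_add_card_filter_not (s := F) X
    have hsplit' : ((F.filter fun ω => ¬ X ω).card : ℝ) = F.card - (F.filter X).card := by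
      rw [← hsplit]
      push_cast
      ring
    rw [hsplit']
    ring
  have e2 : ∑ ω ∈ F, Real.exp (l * g (key ω)) = (F.card : ℝ) * Real.exp (l * g v) := by
    rw [sum_congr rfl fun ω hω => by rw [(mem_filter.mp hω).2], sum_const, nsmul_eq_mul]
  rw [e1, e2]
  have hv' := h v hv
  have hexp := Real.exp_pos (l * g v)
  nlinarith [mul_nonpos_iff.mpr (Or.inl ⟨hexp.le, hv'⟩)]

/-! ### Iteration over `T` steps -/

/-- **Exponential moments of an adapted indicator sum.** Let `X t` be events on the finite set `s`
and `key t` keys such that `X u` for `u < t` is determined by `key t` (on `s`). If for every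
`t < T` and every fibre of `key t` the sign condition `(e^λ − 1)(#(fibre ∩ X t) − r #fibre) ≤ 0`
holds and `1 + r(e^λ − 1) ≥ 0`, then
`∑_ω exp(λ ∑_{t<T} [X t ω]) ≤ (1 + r (e^λ − 1))^T · #s`. [folklore] -/
theorem sum_exp_mul_sum_indicator_le_pow {Ω : Type*} {κ : ℕ → Type*}
    [∀ t, DecidableEq (κ t)] (s : Finset Ω) (key : ∀ t, Ω → κ t) (X : ℕ → Ω → Prop)
    [∀ t, DecidablePred (X t)] (r l : ℝ) (hr : 0 ≤ 1 + r * (Real.exp l - 1))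
    (hkey : ∀ t, ∀ ω ∈ s, ∀ ω' ∈ s, key t ω = key t ω' → ∀ u < t, (X u ω ↔ X u ω'))
    (T : ℕ)
    (h : ∀ t < T, ∀ v ∈ s.image (key t), (Real.exp l - 1) *
      ((((s.filter fun ω => key t ω = v).filter (X t)).card : ℝ) -
        r * ((s.filter fun ω => key t ω = v).card : ℝ)) ≤ 0) :
    ∑ ω ∈ s, Real.exp (l * ∑ t ∈ range T, if X t ω then (1 : ℝ) else 0) ≤
      (1 + r * (Real.exp l - 1)) ^ T * s.card := by
  classical
  induction T with
  | zero => simp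
  | succ T ih =>
    have ih' := ih fun t ht => h t (by omega)
    -- the partial sum `S_T` factors through `key T`
    let g : κ T → ℝ := fun v =>
      if hv : ∃ ω ∈ s, key T ω = v then
        ∑ t ∈ range T, (if X t hv.choose then (1 : ℝ) else 0) else 0
    have hg : ∀ ω ∈ s, (∑ t ∈ range T, if X t ω then (1 : ℝ) else 0) = g (key T ω) := by
      intro ω hω
      have hv : ∃ ω' ∈ s, key T ω' = key T ω := ⟨ω, hω, rfl⟩
      simp only [g, dif_pos hv]
      refine sum_congr rfl fun t ht => ?_
      have hiff := hkey T ω hω hv.choose hv.choose_spec.1 hv.choose_spec.2.symm t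
        (mem_range.mp ht)
      by_cases hX : X t ω
      · rw [if_pos hX, if_pos (hiff.mp hX)]
      · rw [if_neg hX, if_neg (fun h' => hX (hiff.mpr h'))]
    calc ∑ ω ∈ s, Real.exp (l * ∑ t ∈ range (T + 1), if X t ω then (1 : ℝ) else 0)
        = ∑ ω ∈ s, Real.exp (l * (g (key T ω) + if X T ω then 1 else 0)) := by
          refine sum_congr rfl fun ω hω => ?_
          rw [sum_range_succ, hg ω hω]
      _ ≤ (1 + r * (Real.exp l - 1)) * ∑ ω ∈ s, Real.exp (l * g (key T ω)) :=
          sum_exp_mul_add_indicator_le s (key T) g (X T) r l (h T (by omega))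
      _ = (1 + r * (Real.exp l - 1)) *
            ∑ ω ∈ s, Real.exp (l * ∑ t ∈ range T, if X t ω then (1 : ℝ) else 0) := by
          congr 1
          exact sum_congr rfl fun ω hω => by rw [hg ω hω]
      _ ≤ (1 + r * (Real.exp l - 1)) * ((1 + r * (Real.exp l - 1)) ^ T * s.card) :=
          mul_le_mul_of_nonneg_left ih' hr
      _ = (1 + r * (Real.exp l - 1)) ^ (T + 1) * s.card := by ring

/-! ### Markov and the tail bounds -/

/-- Markov's inequality, counting form: if `λ a ≤ λ S(ω)` on the event `P`, then
`#{ω ∈ s : P ω} · exp(λ a) ≤ ∑_ω exp(λ S ω)`. [folklore] -/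
theorem card_filter_mul_exp_le_sum_exp {Ω : Type*} (s : Finset Ω) (S : Ω → ℝ) (P : Ω → Prop)
    [DecidablePred P] (a l : ℝ) (hP : ∀ ω ∈ s, P ω → l * a ≤ l * S ω) :
    ((s.filter P).card : ℝ) * Real.exp (l * a) ≤ ∑ ω ∈ s, Real.exp (l * S ω) := by
  calc ((s.filter P).card : ℝ) * Real.exp (l * a) = ∑ ω ∈ s.filter P, Real.exp (l * a) := by
        rw [sum_const, nsmul_eq_mul]
    _ ≤ ∑ ω ∈ s.filter P, Real.exp (l * S ω) :=
        sum_le_sum fun ω hω => Real.exp_le_exp.mpr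
          (hP ω (mem_filter.mp hω).1 (mem_filter.mp hω).2)
    _ ≤ ∑ ω ∈ s, Real.exp (l * S ω) :=
        sum_le_sum_of_subset_of_nonneg (filter_subset _ _) fun ω _ _ => (Real.exp_pos _).le

/-- **Upper tail.** If every `X t` (`t < T`) has relative frequency `≤ p` on each fibre of `key t`
(`p ≥ 0`), the earlier events being determined by the key, then for every `λ ≥ 0` and `a`,
`#{ω : ∑_{t<T} [X t ω] ≥ a} ≤ #s · exp(T p (e^λ − 1) − λ a)`. [folklore] -/
theorem card_filter_sum_indicator_ge_le {Ω : Type*} {κ : ℕ → Type*} [∀ t, DecidableEq (κ t)]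
    (s : Finset Ω) (key : ∀ t, Ω → κ t) (X : ℕ → Ω → Prop) [∀ t, DecidablePred (X t)]
    {p : ℝ} (hp : 0 ≤ p)
    (hkey : ∀ t, ∀ ω ∈ s, ∀ ω' ∈ s, key t ω = key t ω' → ∀ u < t, (X u ω ↔ X u ω'))
    (T : ℕ)
    (hX : ∀ t < T, ∀ v ∈ s.image (key t),
      ((((s.filter fun ω => key t ω = v).filter (X t)).card : ℝ)) ≤
        p * ((s.filter fun ω => key t ω = v).card : ℝ))
    {l : ℝ} (hl : 0 ≤ l) (a : ℝ) :
    ((s.filter fun ω => a ≤ ∑ t ∈ range T, if X t ω then (1 : ℝ) else 0).card : ℝ) ≤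
      s.card * Real.exp (T * p * (Real.exp l - 1) - l * a) := by
  have hel : 0 ≤ Real.exp l - 1 := by linarith [Real.add_one_le_exp l, Real.exp_pos l]
  have hr : 0 ≤ 1 + p * (Real.exp l - 1) := by positivity
  have hsign : ∀ t < T, ∀ v ∈ s.image (key t), (Real.exp l - 1) *
      ((((s.filter fun ω => key t ω = v).filter (X t)).card : ℝ) -
        p * ((s.filter fun ω => key t ω = v).card : ℝ)) ≤ 0 :=
    fun t ht v hv => mul_nonpos_iff.mpr (Or.inl ⟨hel, by linarith [hX t ht v hv]⟩)
  have hmom := sum_exp_mul_sum_indicator_le_pow s key X p l hr hkey T hsign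
  have hmarkov := card_filter_mul_exp_le_sum_exp s
    (fun ω => ∑ t ∈ range T, if X t ω then (1 : ℝ) else 0)
    (fun ω => a ≤ ∑ t ∈ range T, if X t ω then (1 : ℝ) else 0) a l
    fun ω _ hω => mul_le_mul_of_nonneg_left hω hl
  -- `(1 + p(e^λ-1))^T ≤ exp(T p (e^λ - 1))`
  have hpow : (1 + p * (Real.exp l - 1)) ^ T ≤ Real.exp (T * p * (Real.exp l - 1)) := by
    calc (1 + p * (Real.exp l - 1)) ^ T ≤ (Real.exp (p * (Real.exp l - 1))) ^ T :=
          pow_le_pow_left₀ hr (by linarith [Real.add_one_le_exp (p * (Real.exp l - 1))]) T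
      _ = Real.exp (T * p * (Real.exp l - 1)) := by
          rw [← Real.exp_nat_mul]
          ring_nf
  have hcard : ((s.filter fun ω => a ≤ ∑ t ∈ range T, if X t ω then (1 : ℝ) else 0).card : ℝ) *
      Real.exp (l * a) ≤ s.card * Real.exp (T * p * (Real.exp l - 1)) := by
    refine hmarkov.trans (hmom.trans ?_)
    rw [mul_comm]
    exact mul_le_mul_of_nonneg_left hpow (Nat.cast_nonneg _)
  rw [Real.exp_sub, ← mul_div_assoc, le_div_iff₀ (Real.exp_pos _)]
  exact hcard

/-- **Lower tail.** If every `X t` (`t < T`) has relative frequency `≥ q` on each fibre of `key t`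
(`0 ≤ q ≤ 1`), then for every `λ ≥ 0` and `a`,
`#{ω : ∑_{t<T} [X t ω] ≤ a} ≤ #s · exp(T q (e^{−λ} − 1) + λ a)`. [folklore] -/
theorem card_filter_sum_indicator_le_le {Ω : Type*} {κ : ℕ → Type*} [∀ t, DecidableEq (κ t)]
    (s : Finset Ω) (key : ∀ t, Ω → κ t) (X : ℕ → Ω → Prop) [∀ t, DecidablePred (X t)]
    {q : ℝ} (hq : 0 ≤ q) (hq1 : q ≤ 1)
    (hkey : ∀ t, ∀ ω ∈ s, ∀ ω' ∈ s, key t ω = key t ω' → ∀ u < t, (X u ω ↔ X u ω'))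
    (T : ℕ)
    (hX : ∀ t < T, ∀ v ∈ s.image (key t),
      q * ((s.filter fun ω => key t ω = v).card : ℝ) ≤
        (((s.filter fun ω => key t ω = v).filter (X t)).card : ℝ))
    {l : ℝ} (hl : 0 ≤ l) (a : ℝ) :
    ((s.filter fun ω => (∑ t ∈ range T, if X t ω then (1 : ℝ) else 0) ≤ a).card : ℝ) ≤
      s.card * Real.exp (T * q * (Real.exp (-l) - 1) + l * a) := by
  have hel : Real.exp (-l) - 1 ≤ 0 := by
    have := Real.exp_le_one_iff.mpr (by linarith : -l ≤ 0)
    linarith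
  have hel' : -1 ≤ Real.exp (-l) - 1 := by linarith [Real.exp_pos (-l)]
  have hr : 0 ≤ 1 + q * (Real.exp (-l) - 1) := by nlinarith
  have hsign : ∀ t < T, ∀ v ∈ s.image (key t), (Real.exp (-l) - 1) *
      ((((s.filter fun ω => key t ω = v).filter (X t)).card : ℝ) -
        q * ((s.filter fun ω => key t ω = v).card : ℝ)) ≤ 0 :=
    fun t ht v hv => mul_nonpos_iff.mpr (Or.inr ⟨hel, by linarith [hX t ht v hv]⟩)
  have hmom := sum_exp_mul_sum_indicator_le_pow s key X q (-l) hr hkey T hsign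
  have hmarkov := card_filter_mul_exp_le_sum_exp s
    (fun ω => ∑ t ∈ range T, if X t ω then (1 : ℝ) else 0)
    (fun ω => (∑ t ∈ range T, if X t ω then (1 : ℝ) else 0) ≤ a) a (-l)
    fun ω _ hω => by nlinarith
  have hpow : (1 + q * (Real.exp (-l) - 1)) ^ T ≤ Real.exp (T * q * (Real.exp (-l) - 1)) := by
    calc (1 + q * (Real.exp (-l) - 1)) ^ T ≤ (Real.exp (q * (Real.exp (-l) - 1))) ^ T :=
          pow_le_pow_left₀ hr (by linarith [Real.add_one_le_exp (q * (Real.exp (-l) - 1))]) T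
      _ = Real.exp (T * q * (Real.exp (-l) - 1)) := by
          rw [← Real.exp_nat_mul]
          ring_nf
  have hcard : ((s.filter fun ω => (∑ t ∈ range T, if X t ω then (1 : ℝ) else 0) ≤ a).card : ℝ) *
      Real.exp (-l * a) ≤ s.card * Real.exp (T * q * (Real.exp (-l) - 1)) := by
    refine hmarkov.trans (hmom.trans ?_)
    rw [mul_comm]
    exact mul_le_mul_of_nonneg_left hpow (Nat.cast_nonneg _)
  have e : T * q * (Real.exp (-l) - 1) + l * a = T * q * (Real.exp (-l) - 1) - (-l * a) := by ring
  rw [e, Real.exp_sub, ← mul_div_assoc, le_div_iff₀ (Real.exp_pos _)]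
  exact hcard

/-! ### Small deviations -/

/-- `e^x − 1 − x ≤ x²` for `|x| ≤ 1` (Mathlib's `Real.abs_exp_sub_one_sub_id_le`). [folklore] -/
theorem exp_sub_one_sub_le_sq {x : ℝ} (hx : |x| ≤ 1) : Real.exp x - 1 - x ≤ x ^ 2 :=
  (le_abs_self _).trans (Real.abs_exp_sub_one_sub_id_le hx)

/-- **Chernoff upper tail, small deviations**: under the hypotheses of
`card_filter_sum_indicator_ge_le`, for `0 ≤ δ ≤ 2`,
`#{ω : ∑_{t<T} [X t ω] ≥ (1+δ) T p} ≤ #s · exp(−δ² T p / 4)` (take `λ = δ/2`). [folklore] -/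
theorem card_filter_sum_indicator_ge_le_exp {Ω : Type*} {κ : ℕ → Type*} [∀ t, DecidableEq (κ t)]
    (s : Finset Ω) (key : ∀ t, Ω → κ t) (X : ℕ → Ω → Prop) [∀ t, DecidablePred (X t)]
    {p : ℝ} (hp : 0 ≤ p)
    (hkey : ∀ t, ∀ ω ∈ s, ∀ ω' ∈ s, key t ω = key t ω' → ∀ u < t, (X u ω ↔ X u ω'))
    (T : ℕ)
    (hX : ∀ t < T, ∀ v ∈ s.image (key t),
      ((((s.filter fun ω => key t ω = v).filter (X t)).card : ℝ)) ≤
        p * ((s.filter fun ω => key t ω = v).card : ℝ))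
    {δ : ℝ} (hδ : 0 ≤ δ) (hδ2 : δ ≤ 2) :
    ((s.filter fun ω =>
        (1 + δ) * (T * p) ≤ ∑ t ∈ range T, if X t ω then (1 : ℝ) else 0).card : ℝ) ≤
      s.card * Real.exp (-(δ ^ 2 * (T * p) / 4)) := by
  have h := card_filter_sum_indicator_ge_le s key X hp hkey T hX (by positivity : 0 ≤ δ / 2)
    ((1 + δ) * (T * p))
  refine h.trans (mul_le_mul_of_nonneg_left (Real.exp_le_exp.mpr ?_) (Nat.cast_nonneg _))
  have hb := exp_sub_one_sub_le_sq (x := δ / 2) (by rw [abs_of_nonneg (by positivity)]; linarith)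
  have hTp : 0 ≤ (T : ℝ) * p := by positivity
  nlinarith [mul_le_mul_of_nonneg_left hb hTp]

/-- **Chernoff lower tail, small deviations**: under the hypotheses of
`card_filter_sum_indicator_le_le`, for `0 ≤ δ ≤ 2`,
`#{ω : ∑_{t<T} [X t ω] ≤ (1−δ) T q} ≤ #s · exp(−δ² T q / 4)`. [folklore] -/
theorem card_filter_sum_indicator_le_le_exp {Ω : Type*} {κ : ℕ → Type*} [∀ t, DecidableEq (κ t)]
    (s : Finset Ω) (key : ∀ t, Ω → κ t) (X : ℕ → Ω → Prop) [∀ t, DecidablePred (X t)]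
    {q : ℝ} (hq : 0 ≤ q) (hq1 : q ≤ 1)
    (hkey : ∀ t, ∀ ω ∈ s, ∀ ω' ∈ s, key t ω = key t ω' → ∀ u < t, (X u ω ↔ X u ω'))
    (T : ℕ)
    (hX : ∀ t < T, ∀ v ∈ s.image (key t),
      q * ((s.filter fun ω => key t ω = v).card : ℝ) ≤
        (((s.filter fun ω => key t ω = v).filter (X t)).card : ℝ))
    {δ : ℝ} (hδ : 0 ≤ δ) (hδ2 : δ ≤ 2) :
    ((s.filter fun ω =>
        (∑ t ∈ range T, if X t ω then (1 : ℝ) else 0) ≤ (1 - δ) * (T * q)).card : ℝ) ≤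
      s.card * Real.exp (-(δ ^ 2 * (T * q) / 4)) := by
  have h := card_filter_sum_indicator_le_le s key X hq hq1 hkey T hX (by positivity : 0 ≤ δ / 2)
    ((1 - δ) * (T * q))
  refine h.trans (mul_le_mul_of_nonneg_left (Real.exp_le_exp.mpr ?_) (Nat.cast_nonneg _))
  have hb := exp_sub_one_sub_le_sq (x := -(δ / 2))
    (by rw [abs_neg, abs_of_nonneg (by positivity)]; linarith)
  have hTq : 0 ≤ (T : ℝ) * q := by positivity
  nlinarith [mul_le_mul_of_nonneg_left hb hTq]

end Literature.Probability.Moments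

end
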